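import Literature.NumberTheory.EllipticCurves.ModularCurveManinSemistableProofs
import Literature.NumberTheory.EllipticCurves.EichlerShimuraConstructionKernelProofs
import HarnessLib

/-!
# `abs_maninConstant_eq_one_of_isSemistable`: its open input `hES` is the curve-free kernel of
# the Eichler–Shimura cluster

Topic `NumberTheory/EllipticCurves`; a proofs-only companion (theorems only: no definitions, no
named facts) of `ModularCurveManinSemistableProofs.lean`. That file reduced the named fact
`ModularParametrizationData.abs_maninConstant_eq_one_of_isSemistable` (`ModularCurve.lean`;
Česnavičius 2018, Thm. 1.2: the Manin constant of a new elliptic optimal quotient of `J₀(N)` is a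
unit at every `p` with `p² ∤ N`, so `c = ±1` for semistable optimal curves) to two inline
hypotheses — `hES`, the Eichler–Shimura construction *with its period lattice* (a `ℚ`-model `W₀`
of the strong Weil curve with `aₙ(W₀) = aₙ(f)` for all `n` and a Néron-type period pair spanning
exactly `Λ_f`; Knapp 1993, Thm. 11.74 (c)–(e) with Thm. 12.8, Prop. 12.9 (a) and PDF p. 302;
Cremona 1997, §2.14), and `hCes`, Česnavičius's theorem in lattice form — all glue being proved
(`ModularParametrizationData.abs_maninConstant_eq_one_of_isSemistable_of`).

Independently, `EichlerShimuraConstructionKernelProofs.lean` isolated the open content of the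
whole "(2) ⇒ (6)" cluster of the tree (`eichlerShimuraConstruction`,
`IsNewformOf.exists_maninConstant_ne_zero`, `exists_weierstrassCurve_of_rational_isNewform0`,
`nonempty_modularParametrizationData`) in one **curve-free kernel `H`**: for a newform
`f ∈ S₂(Γ₀(N))` with `K_f = ℚ` and a period pair `L` spanning `Λ_f` there are `a₄, a₆ ∈ ℚ` with
`g₂(L) = -4a₄`, `g₃(L) = -4a₆` and `a_p(y² = x³ + a₄x + a₆) = a_p(f)` for the primes `p ∤ N`
(Cremona 1997, §2.14, "since `E_f` is defined over `ℚ`, the numbers `c₄` and `c₆` are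
rational"; Knapp 1993, Thm. 11.74 (d)–(e) with PDF p. 302), and proved `H` equivalent to the
strong Weil statement (`rational_invariants_iff_strongWeil`).

This file shows that **`hES` is that same kernel**, so that the two reductions share one open
input:

* `exists_latticeEq_model_of_rational_invariants` — `H` gives `hES`, granted modularity
  (`exists_isNewformOf`, Breuil–Conrad–Diamond–Taylor 2001, Thm. A, used only for Carayol's part
  "`aₙ(f) = aₙ(W₀)` for *all* `n`" through strong multiplicity one,
  `isNewformOf_of_cuspCoeff_prime_eq`): take `W₀ := y² = x³ + a₄x + a₆` (elliptic,
  `isElliptic_shortModel`) and `L₀ := L_f`, a period pair spanning `Λ_f`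
  (`IsNewform0.exists_periodPair_of_coeffField_eq_bot`), which is Néron-type for `W₀`
  (`isNeronLatticeOf_shortModel`: `c₄/12 = g₂`, `c₆/216 = g₃`).
* `rational_invariants_of_exists_latticeEq_model` — conversely `hES` at `(N, f)` gives `H` at
  `(N, f)` outright: a `ℚ`-isomorphic short model of `W₀` has Néron-type lattice `Λ_f`
  (`exists_shortModel_of_lattice_eq_smul` with `c = 1`) and the same `L`-function
  (`WeierstrassCurve.LFunction_smul`).
* `exists_latticeEq_model_iff_rational_invariants` — hence `hES ↔ H` granted modularity: `hES`
  is a faithful transcription of Knapp's Thm. 11.74 (d)–(e) with the rational Manin constant,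
  neither weaker nor stronger.
* `ModularParametrizationData.abs_maninConstant_eq_one_of_isSemistable_of_rational_invariants`
  — the vendored fact from modularity, `H` and `hCes`. So the open content of
  `abs_maninConstant_eq_one_of_isSemistable` beyond the tree's named fact `exists_isNewformOf`
  is exactly `H` (shared with the Eichler–Shimura cluster; `X₀(N)` and `J₀(N)` over `ℚ` and
  `𝔽_p`, the Eichler–Shimura congruence relation) and `hCes` (Česnavičius's theorem proper:
  Néron models of `J₀(N)` and of `E` over `ℤ_(p)`, the Deligne–Rapoport model of `X₀(N)`,
  Grothendieck duality and multiplicity one; Česnavičius 2018, §2).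
* `ModularParametrizationData.cesnavicius_latticeForm_of_forall_abs_maninConstant_eq_one` and
  `ModularParametrizationData.forall_abs_maninConstant_eq_one_of_isSemistable_iff` — conversely,
  the fact for *all* data (its universal closure, i.e. what a discharge proves) gives back `hCes`
  with no further input, since a datum with `c Λ_f = Λ_E` has minimal degree among all data with
  its newform (`forall_modularDegree_le_of_latticeEq`; Knapp 1993, Prop. 12.9 (a)); hence,
  granted `hES` (resp. modularity and `H`,
  `forall_abs_maninConstant_eq_one_of_isSemistable_iff_of_rational_invariants`), the universal
  closure of the fact is *equivalent* to `hCes`: the lattice form is exactly what a discharge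
  must prove, neither weaker nor stronger.

Nothing is discharged and no statement of the tree is changed.

## References

* K. Česnavičius, *The Manin constant in the semistable case*, Compositio Math. 154 (2018),
  1889–1920: Thm. 1.2 and §2. [Cesnavicius2018]
* A. W. Knapp, *Elliptic Curves*, Math. Notes 40, Princeton 1993: Thm. 11.74 with Remarks
  (PDF p. 287), Thm. 12.8 (PDF p. 301), Prop. 12.9 (a) and PDF p. 302. [Knapp1993]
* J. E. Cremona, *Algorithms for modular elliptic curves*, 2nd ed., CUP 1997: §2.14
  (pp. 33–34). [CremonaAlgorithms1997]
* C. Breuil, B. Conrad, F. Diamond, R. Taylor, *On the modularity of elliptic curves over `ℚ`: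
  wild 3-adic exercises*, J. Amer. Math. Soc. 14 (2001), 843–939: Thm. A. [BCDTJAMS2001]
-/

noncomputable section

open scoped MatrixGroups ModularForm Pointwise

open CongruenceSubgroup UpperHalfPlane

namespace Literature.NumberTheory.EllipticCurves.ModularForms

/-! ### `hES` from the curve-free kernel `H`, and back -/

section Kernel

/-- **The curve-free kernel `H` gives the Eichler–Shimura construction with its period lattice
(`hES`), granted modularity.** For a newform `f ∈ S₂(Γ₀(N))` with `K_f = ℚ`, let `L_f` be a
period pair spanning `Λ_f` (`IsNewform0.exists_periodPair_of_coeffField_eq_bot`; Shimura 1971,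
Thm. 7.14: `Λ_f` is a lattice) and `a₄, a₆ ∈ ℚ` as in `H`. Then `W₀ := y² = x³ + a₄x + a₆` is an
elliptic curve over `ℚ` (`isElliptic_shortModel`), `L_f` is a Néron-type period pair of `W₀`
(`isNeronLatticeOf_shortModel`) spanning exactly `Λ_f`, and `a_p(W₀) = a_p(f)` for `p ∤ N`
upgrades to `aₙ(W₀) = aₙ(f)` for all `n` (`IsNewformOf W₀ f`) by modularity and strong
multiplicity one (`isNewformOf_of_cuspCoeff_prime_eq`; Carayol's part of Knapp's Thm. 12.8).
[cite: Knapp1993, Thm. 11.74 (d), (e) with Remarks (PDF p. 287), Thm. 12.8 (PDF p. 301) and PDF p. 302]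
[cite: CremonaAlgorithms1997, §2.14 (pp. 33–34)] -/
theorem exists_latticeEq_model_of_rational_invariants (h₁ : exists_isNewformOf)
    (H : ∀ (N : ℕ) [NeZero N] (f : CuspForm (Gamma0 N) 2), IsNewform0 f → coeffField f = ⊥ →
      ∀ (L : PeriodPair), L.lattice.toAddSubgroup = periodLattice f →
        ∃ a₄ a₆ : ℚ, L.g₂ = -4 * (a₄ : ℂ) ∧ L.g₃ = -4 * (a₆ : ℂ) ∧
          ∀ p : ℕ, p.Prime → ¬ p ∣ N →
            (qExpansion 1 ⇑f).coeff p =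
              (({ a₁ := 0, a₂ := 0, a₃ := 0, a₄ := a₄, a₆ := a₆ } : WeierstrassCurve ℚ).LFunction
                p : ℂ))
    {N : ℕ} [NeZero N] {f : CuspForm (Gamma0 N) 2} (hf : IsNewform0 f) (hQ : coeffField f = ⊥) :
    ∃ (W₀ : WeierstrassCurve ℚ) (_ : W₀.IsElliptic), IsNewformOf W₀ f ∧
      ∃ L₀ : PeriodPair, IsNeronLatticeOf (W₀.baseChange ℂ) L₀ ∧
        (L₀.lattice : Set ℂ) = periodLattice f := by
  obtain ⟨Lf, hLf⟩ := hf.exists_periodPair_of_coeffField_eq_bot hQ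
  obtain ⟨a₄, a₆, h₂, h₃, hp⟩ := H N f hf hQ Lf hLf
  haveI := isElliptic_shortModel h₂ h₃
  refine ⟨_, isElliptic_shortModel h₂ h₃,
    (isNewformOf_of_cuspCoeff_prime_eq h₁ hf _ N.divisors.finite_toSet
      fun p hpr hpS ↦ hp p hpr (not_dvd_of_notMem_divisors hpS)).1,
    Lf, isNeronLatticeOf_shortModel h₂ h₃, ?_⟩
  rw [← hLf, Submodule.coe_toAddSubgroup]

/-- **The Eichler–Shimura construction with its period lattice at `(N, f)` gives the curve-free
kernel at `(N, f)`.** If `W₀/ℚ` is elliptic with `aₙ(W₀) = aₙ(f)` for all `n` and has a Néron-type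
period pair `L₀` spanning exactly `Λ_f`, then for every period pair `L` spanning `Λ_f` some
change of variables over `ℚ` takes `W₀` to `y² = x³ + a₄x + a₆` with `g₂(L) = -4a₄`,
`g₃(L) = -4a₆` (`exists_shortModel_of_lattice_eq_smul` with `c = 1`; Silverman AEC III.1,
Table 3.1), and `ℚ`-isomorphic models have the same `L`-function (`WeierstrassCurve.LFunction_smul`),
so `a_p(y² = x³ + a₄x + a₆) = a_p(f)` (at every `p`, in particular for `p ∤ N`). No modularity is
needed in this direction. [cite: Knapp1993, Thm. 11.74 (d), (e) with Remarks (PDF p. 287) and PDF p. 302]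
[cite: SilvermanAEC2009, III.1 Table 3.1 (PDF p. 50)] -/
theorem rational_invariants_of_exists_latticeEq_model {N : ℕ} [NeZero N]
    {f : CuspForm (Gamma0 N) 2}
    (h : ∃ (W₀ : WeierstrassCurve ℚ) (_ : W₀.IsElliptic), IsNewformOf W₀ f ∧
      ∃ L₀ : PeriodPair, IsNeronLatticeOf (W₀.baseChange ℂ) L₀ ∧
        (L₀.lattice : Set ℂ) = periodLattice f)
    (L : PeriodPair) (hL : L.lattice.toAddSubgroup = periodLattice f) :
    ∃ a₄ a₆ : ℚ, L.g₂ = -4 * (a₄ : ℂ) ∧ L.g₃ = -4 * (a₆ : ℂ) ∧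
      ∀ p : ℕ, p.Prime → ¬ p ∣ N →
        (qExpansion 1 ⇑f).coeff p =
          (({ a₁ := 0, a₂ := 0, a₃ := 0, a₄ := a₄, a₆ := a₆ } : WeierstrassCurve ℚ).LFunction p
            : ℂ) := by
  obtain ⟨W₀, hW₀, hf₀, L₀, hL₀, hΛ⟩ := h
  haveI := hW₀
  have hΛ' : (L₀.lattice : Set ℂ) = ((1 : ℚ) : ℂ) • (periodLattice f : Set ℂ) := by
    rw [Rat.cast_one, one_smul, hΛ]
  obtain ⟨a₄, a₆, C, hCW, h₂, h₃⟩ := exists_shortModel_of_lattice_eq_smul hL₀ one_ne_zero hΛ' hL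
  refine ⟨a₄, a₆, h₂, h₃, fun p _ _ ↦ ?_⟩
  rw [← hCW, WeierstrassCurve.LFunction_smul]
  exact hf₀.2 p

/-- **`hES ↔ H`, granted modularity** (`exists_isNewformOf`, used only in `⇐` for Carayol's
part): the Eichler–Shimura construction with its period lattice — the open input `hES` of
`ModularParametrizationData.abs_maninConstant_eq_one_of_isSemistable_of`, here over all newforms
with `K_f = ℚ` — is equivalent to the curve-free kernel `H` of
`EichlerShimuraConstructionKernelProofs.lean`, hence (by `rational_invariants_iff_strongWeil`
there) to the strong Weil statement, Knapp's Thm. 11.74 (d)–(e) with the rational Manin constant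
(Agashe–Ribet–Stein 2006, §2). So `hES` is a faithful transcription of the printed theorem,
neither a weakening nor a strengthening.
[cite: Knapp1993, Thm. 11.74 (d), (e) with Remarks (PDF p. 287), Thm. 12.8 (PDF p. 301) and PDF p. 302]
[cite: CremonaAlgorithms1997, §2.14 (pp. 33–34)] -/
theorem exists_latticeEq_model_iff_rational_invariants (h₁ : exists_isNewformOf) :
    (∀ (N : ℕ) [NeZero N] (f : CuspForm (Gamma0 N) 2), IsNewform0 f → coeffField f = ⊥ →
      ∃ (W₀ : WeierstrassCurve ℚ) (_ : W₀.IsElliptic), IsNewformOf W₀ f ∧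
        ∃ L₀ : PeriodPair, IsNeronLatticeOf (W₀.baseChange ℂ) L₀ ∧
          (L₀.lattice : Set ℂ) = periodLattice f) ↔
    ∀ (N : ℕ) [NeZero N] (f : CuspForm (Gamma0 N) 2), IsNewform0 f → coeffField f = ⊥ →
      ∀ (L : PeriodPair), L.lattice.toAddSubgroup = periodLattice f →
        ∃ a₄ a₆ : ℚ, L.g₂ = -4 * (a₄ : ℂ) ∧ L.g₃ = -4 * (a₆ : ℂ) ∧
          ∀ p : ℕ, p.Prime → ¬ p ∣ N →
            (qExpansion 1 ⇑f).coeff p =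
              (({ a₁ := 0, a₂ := 0, a₃ := 0, a₄ := a₄, a₆ := a₆ } : WeierstrassCurve ℚ).LFunction
                p : ℂ) :=
  ⟨fun h N _ f hf hQ L hL ↦ rational_invariants_of_exists_latticeEq_model (h N f hf hQ) L hL,
    fun H _ _ _ hf hQ ↦ exists_latticeEq_model_of_rational_invariants h₁ H hf hQ⟩

end Kernel

/-! ### The vendored fact from modularity, the curve-free kernel and Česnavičius's theorem -/

namespace ModularParametrizationData

variable {W : WeierstrassCurve ℚ} {N : ℕ} [NeZero N] (D : ModularParametrizationData W N)

/-- **`abs_maninConstant_eq_one_of_isSemistable` from modularity, the curve-free Eichler–Shimura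
kernel `H` and Česnavičius's theorem in lattice form.** The input `hES` of
`abs_maninConstant_eq_one_of_isSemistable_of` is supplied by
`exists_latticeEq_model_of_rational_invariants` (a newform with integer coefficients has
`K_f = ℚ`, `coeffField_eq_bot_of_forall_exists_intCast`); `hCes` is, verbatim, Česnavičius's
theorem in lattice form as there: for a globally minimal model `W'/ℚ` (so `ω_{W'}` is a Néron
differential) of a semistable elliptic curve and a datum `D'` with `c Λ_f = Λ_{E'}` — `φ_{D'}` is
the optimal parametrisation of the strong Weil curve followed by the `ℚ`-isomorphism `z ↦ c z`,
so `c = ±c_π` for the new elliptic optimal quotient `π : J₀(N') ↠ E'` — one has `|c| = 1`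
(Česnavičius 2018, Thm. 1.2, with `N' = N_{E'}` squarefree; `c_π ∈ ℤ` by Edixhoven 1991, Prop. 2).
So the open content of the vendored fact beyond the named fact `exists_isNewformOf` is `H`, shared
with the Eichler–Shimura cluster, and `hCes`. [cite: Cesnavicius2018, Thm. 1.2] -/
theorem abs_maninConstant_eq_one_of_isSemistable_of_rational_invariants
    (h₁ : exists_isNewformOf)
    (H : ∀ (N : ℕ) [NeZero N] (f : CuspForm (Gamma0 N) 2), IsNewform0 f → coeffField f = ⊥ →
      ∀ (L : PeriodPair), L.lattice.toAddSubgroup = periodLattice f →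
        ∃ a₄ a₆ : ℚ, L.g₂ = -4 * (a₄ : ℂ) ∧ L.g₃ = -4 * (a₆ : ℂ) ∧
          ∀ p : ℕ, p.Prime → ¬ p ∣ N →
            (qExpansion 1 ⇑f).coeff p =
              (({ a₁ := 0, a₂ := 0, a₃ := 0, a₄ := a₄, a₆ := a₆ } : WeierstrassCurve ℚ).LFunction
                p : ℂ))
    (hCes : ∀ (W' : WeierstrassCurve ℚ) [W'.IsElliptic] [W'.IsGloballyMinimal] {N' : ℕ}
      [NeZero N'] (D' : ModularParametrizationData W' N'), W'.IsSemistable ℤ →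
      (∀ z ∈ D'.L.lattice, ∃ w ∈ periodLattice D'.f, z = D'.c * w) → |D'.maninConstant| = 1) :
    D.abs_maninConstant_eq_one_of_isSemistable :=
  D.abs_maninConstant_eq_one_of_isSemistable_of
    (fun hf hint ↦ exists_latticeEq_model_of_rational_invariants h₁ H hf
      (coeffField_eq_bot_of_forall_exists_intCast hint))
    hCes

/-! ### The converse: the fact, universally closed, gives back Česnavičius's lattice form -/

/-- **Optimal data satisfy the minimality hypothesis of the fact.** If `c Λ_f = Λ_E` for `D`
(the isogeny `z ↦ c z : ℂ/Λ_f → ℂ/Λ_E` is injective, `isogenyMap_ker_eq_bot_iff`), then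
`deg φ_D ≤ deg φ_{D'}` for every datum `D'`, at the same level and with the same newform, of every
elliptic `W'/ℚ` — the isogeny-free optimality hypothesis of
`abs_maninConstant_eq_one_of_isSemistable` (`modularDegree_le_of_isogenyMap_ker_eq_bot`:
`deg φ_{D'} = [Λ_{E'} : c' Λ_f] · deg φ_D`; the strong Weil curve has the parametrisation of
least degree in its class, Knapp 1993, Prop. 12.9 (a) and p. 302). [cite: Knapp1993, Prop. 12.9(a) and p. 302] -/
theorem forall_modularDegree_le_of_latticeEq
    (hlat : ∀ z ∈ D.L.lattice, ∃ w ∈ periodLattice D.f, z = D.c * w)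
    (W' : WeierstrassCurve ℚ) [W'.IsElliptic] (D' : ModularParametrizationData W' N)
    (hf : D'.f = D.f) : D.modularDegree ≤ D'.modularDegree :=
  D.modularDegree_le_of_isogenyMap_ker_eq_bot (D.isogenyMap_ker_eq_bot_iff.mpr hlat) D' hf

/-- **The fact, for all data, implies Česnavičius's theorem in lattice form.** If
`abs_maninConstant_eq_one_of_isSemistable` holds for *every* parametrisation datum (its universal
closure, i.e. what a discharge `_holds` proves), then `hCes` holds: for a globally minimal model
`W'/ℚ` of a semistable elliptic curve and a datum `D'` with `c Λ_f = Λ_{E'}`, `|c| = 1` — because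
such a `D'` has minimal degree among all data with the same newform
(`forall_modularDegree_le_of_latticeEq`), so the fact applies to `D'` itself. This direction uses
no input beyond the tree. [cite: Cesnavicius2018, Thm. 1.2] -/
theorem cesnavicius_latticeForm_of_forall_abs_maninConstant_eq_one
    (h : ∀ {W' : WeierstrassCurve ℚ} {N' : ℕ} [NeZero N'] (D' : ModularParametrizationData W' N'),
      D'.abs_maninConstant_eq_one_of_isSemistable)
    (W' : WeierstrassCurve ℚ) [W'.IsElliptic] [W'.IsGloballyMinimal] {N' : ℕ} [NeZero N']
    (D' : ModularParametrizationData W' N') (hss : W'.IsSemistable ℤ)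
    (hlat : ∀ z ∈ D'.L.lattice, ∃ w ∈ periodLattice D'.f, z = D'.c * w) :
    |D'.maninConstant| = 1 :=
  h D' hss (D'.forall_modularDegree_le_of_latticeEq hlat)

/-- **The exact open content.** Granted the Eichler–Shimura construction with its period lattice
(`hES`, as in `abs_maninConstant_eq_one_of_isSemistable_of`; Knapp 1993, Thm. 11.74 (c)–(e) with
Thm. 12.8, Prop. 12.9 (a) and PDF p. 302), the universal closure of the vendored fact
`abs_maninConstant_eq_one_of_isSemistable` is **equivalent** to Česnavičius's theorem in lattice
form `hCes` (`|c| = 1` for every datum with `c Λ_f = Λ_{E'}` of a globally minimal model of a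
semistable elliptic curve over `ℚ`; Česnavičius 2018, Thm. 1.2 with Edixhoven 1991, Prop. 2):
`⇒` is `cesnavicius_latticeForm_of_forall_abs_maninConstant_eq_one` (no input needed), `⇐` is
`abs_maninConstant_eq_one_of_isSemistable_of`. So `hCes` is neither weaker nor stronger than what
a discharge must prove, and the fact is a faithful transcription of the printed theorem for
`Γ₀(N)`-optimal semistable curves. [cite: Cesnavicius2018, Thm. 1.2] -/
theorem forall_abs_maninConstant_eq_one_of_isSemistable_iff
    (hES : ∀ {N : ℕ} [NeZero N] {f : CuspForm (Gamma0 N) 2}, IsNewform0 f →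
      (∀ n : ℕ, ∃ a : ℤ, cuspCoeff f n = a) →
      ∃ (W₀ : WeierstrassCurve ℚ) (_ : W₀.IsElliptic), IsNewformOf W₀ f ∧
        ∃ L₀ : PeriodPair, IsNeronLatticeOf (W₀.baseChange ℂ) L₀ ∧
          (L₀.lattice : Set ℂ) = periodLattice f) :
    (∀ {W' : WeierstrassCurve ℚ} {N' : ℕ} [NeZero N'] (D' : ModularParametrizationData W' N'),
      D'.abs_maninConstant_eq_one_of_isSemistable) ↔
    ∀ (W' : WeierstrassCurve ℚ) [W'.IsElliptic] [W'.IsGloballyMinimal] {N' : ℕ} [NeZero N']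
      (D' : ModularParametrizationData W' N'), W'.IsSemistable ℤ →
      (∀ z ∈ D'.L.lattice, ∃ w ∈ periodLattice D'.f, z = D'.c * w) → |D'.maninConstant| = 1 :=
  ⟨fun h W' _ _ _ _ D' hss hlat ↦
      cesnavicius_latticeForm_of_forall_abs_maninConstant_eq_one h W' D' hss hlat,
    fun hCes _ _ _ D' ↦ D'.abs_maninConstant_eq_one_of_isSemistable_of hES hCes⟩

/-- **The exact open content, curve-free form.** Granted modularity (`exists_isNewformOf`) and
the curve-free Eichler–Shimura kernel `H` (rational invariants `g₂(Λ_f)`, `g₃(Λ_f)` with the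
point count at `p ∤ N`; Cremona 1997, §2.14; Knapp 1993, Thm. 11.74 (d)–(e)), the universal
closure of `abs_maninConstant_eq_one_of_isSemistable` is equivalent to Česnavičius's theorem in
lattice form `hCes`: combine `forall_abs_maninConstant_eq_one_of_isSemistable_iff` with
`exists_latticeEq_model_of_rational_invariants`. [cite: Cesnavicius2018, Thm. 1.2] -/
theorem forall_abs_maninConstant_eq_one_of_isSemistable_iff_of_rational_invariants
    (h₁ : exists_isNewformOf)
    (H : ∀ (N : ℕ) [NeZero N] (f : CuspForm (Gamma0 N) 2), IsNewform0 f → coeffField f = ⊥ →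
      ∀ (L : PeriodPair), L.lattice.toAddSubgroup = periodLattice f →
        ∃ a₄ a₆ : ℚ, L.g₂ = -4 * (a₄ : ℂ) ∧ L.g₃ = -4 * (a₆ : ℂ) ∧
          ∀ p : ℕ, p.Prime → ¬ p ∣ N →
            (qExpansion 1 ⇑f).coeff p =
              (({ a₁ := 0, a₂ := 0, a₃ := 0, a₄ := a₄, a₆ := a₆ } : WeierstrassCurve ℚ).LFunction
                p : ℂ)) :
    (∀ {W' : WeierstrassCurve ℚ} {N' : ℕ} [NeZero N'] (D' : ModularParametrizationData W' N'),
      D'.abs_maninConstant_eq_one_of_isSemistable) ↔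
    ∀ (W' : WeierstrassCurve ℚ) [W'.IsElliptic] [W'.IsGloballyMinimal] {N' : ℕ} [NeZero N']
      (D' : ModularParametrizationData W' N'), W'.IsSemistable ℤ →
      (∀ z ∈ D'.L.lattice, ∃ w ∈ periodLattice D'.f, z = D'.c * w) → |D'.maninConstant| = 1 :=
  forall_abs_maninConstant_eq_one_of_isSemistable_iff fun hf hint ↦
    exists_latticeEq_model_of_rational_invariants h₁ H hf
      (coeffField_eq_bot_of_forall_exists_intCast hint)

end ModularParametrizationData

end Literature.NumberTheory.EllipticCurves.ModularForms

end
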